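import Mathlib
import Summits.Ventures.HodgeRepro.Tier4.Line1.InstanceDisplay

/-!
# Tier4/Line1/InstanceDisplayMin — THE MINIMAL DISPLAY OF LINE L1's v3 RESIDUAL AS A TREE THEOREM: no `Lift`, no `hlift`,
no type clause, the block `∃`-quantified (C-L1-DISPLAY-MIN, plan-1 S14710 / S14713)

Blind re-derivation cell `pub-hodge-repro`, Tier 4 (README §9–§10), seat t4-L1-p1 (gen 3).  Target tree path
`lean/Summits/Ventures/HodgeRepro/Tier4/Line1/InstanceDisplayMin.lean`.  Imports t4-L1-p5's `InstanceDisplay` (p696781: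
`instanceSupport`, `instanceCore`, `isolationRealised_ofAdelic_instance`, `P_T4v3_of_instance_displayed`) and through it
this seat's `RTFConclusionV3` (`P_T4v3_of_rtf_isolated`), `SpectralOfRTFIsolated` (`spectralIdentificationAt_iff_J`),
t4-L1-p4's `IsolatingTestsFiniteRankTypeBiInvariant` (`defined_inputs_realisable_finiteRankType_biInvariant_of_totallyDefinite`),
`RealisedSetting` (`isCharacter_ofAdelic`, `isCharacter'_ofAdelic`).

WHAT THIS IS (the tree twin of plan-1's v0.45 `target_L1_v3_of_display_min` / `display_min_of_display`, crit-2 S14684 (a)(b)).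
p5's `P_T4v3_of_instance_displayed` asks the display for EVERY defined block of the plane and carries a lift clause `Lift` with
`hlift`.  Both are contentless for the ISOLATED assembly: `P_T4v3_of_rtf_isolated` uses only the five J2 clauses of one block
and `isolationRealised_ofAdelic_instance` proves (S3″) for every `Lift`, so `Lift := fun _ => True` discharges `hlift`; the
finite-rank-type and bi-invariance clauses of the pair served (S1b), which the isolated assembly never consults.
* `P_T4v3_of_instance_displayed_min` — `P_T4v3` from the ONE hypothesis that displays, per datum: a level with `N2` + `hcc`,
  a totally definite genuine plane with torus data and the four character clauses, an adapted ONB, an isolating pair with its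
  five J2 clauses, and the content: a level `N ≠ 0` with a K-type `σ`, Hecke test pairs `tf` with the seesaw identity (S1a)
  `HodgePairingEqJ`, and row (6) on the instance — multiplicity one of the cores `hM`, the test-vector clauses `hPA`/`hPA'`
  (Rallis' non-vanishing IN the block), the dictionary `hreal` — p5's four clauses VERBATIM.
* `instance_displayed_min_of_displayed` — the minimal display is the WEAKER hypothesis: p5's `∀`-block display at one plane
  supplies it (p4's block by name, its own level `N`, `Lift`/`hlift` discarded).
The theorems DISPLAY the residual, they do not discharge it: nothing of the costumes is touched, `P_T4v3` is not moved.
Nothing here says anything about the status of the Hodge conjecture for CM abelian varieties, which is NOT proved (HC_CM is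
NOT proved by anyone in this repository).
-/

set_option autoImplicit false

noncomputable section

namespace Summit.Ventures.HodgeRepro.Tier4.Line1

open MeasureTheory Topology NumberField Common RTF

section PackerMin

/-- **THE v3 RESIDUAL OF LINE L1 WITH THE MINIMAL DISPLAY** (C-L1-DISPLAY-MIN): `P_T4v3` from the hypothesis that displays, per
datum, the level + `N2` + `hcc`, the plane/torus/character data, ONE adapted ONB, ONE isolating pair (five J2 clauses), and
the content — a level `N ≠ 0` with a K-type `σ`, test pairs `tf` with the seesaw identity (S1a), and row (6) on the instance
(`hM`, `hPA`, `hPA'`, `hreal`).  No `Lift`, no `hlift`, no type clause: `Lift := fun _ => True`, (S1″) from (S1a) alone,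
(S3″) from row (6). -/
theorem P_T4v3_of_instance_displayed_min
    (h : ∀ (F E : Type) [Field F] [NumberField F] [IsGalois ℚ F] [IsCMField F]
      [Field E] [NumberField E] [IsGalois ℚ E] [IsCMField E] (d : TargetData F E),
      ∃ (Γ' : Set (Matrix (Fin 3) (Fin 3) E)) (hΓ' : d.IsLevel Γ') (a' : ∀ i : Fin 4, (Fin 2 → ℂ) → (↥(d.T i) → ℂ))
        (ha' : ∀ i, IsAlbaneseLift (d.T i) (d.Λ i) d.τ₀ d.C Γ' (a' i)),
        (d.relevel Γ' hΓ'.1 a' ha').N2 ∧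
        ∃ hcc : (d.relevel Γ' hΓ'.1 a' ha').IsCocompact Γ',
        ∃ (k : Type) (_ : Field k) (_ : NumberField k) (pl : PlaneData k) (hdef : IsDefinite pl)
          (hgen : IsGenuineRow pl) (_ : MeasurableSpace (GA pl)) (_ : BorelSpace (GA pl)) (R : RTFData pl)
          (μ : Measure (GA pl)) (_ : μ.IsHaarMeasure) (_ : R.μT.IsHaarMeasure) (_ : R.μT'.IsHaarMeasure)
          (hT : IsCompact (closure R.DT)) (hT' : IsCompact (closure R.DT')) (htot : IsTotallyDefinite pl)
          (_ : Continuous R.chi) (_ : ∀ a, ‖R.chi a‖ = 1) (_ : Continuous R.chi') (_ : ∀ a, ‖R.chi' a‖ = 1)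
          (τ : ℕ → Set (GA pl → ℂ)) (φ : ℕ → GA pl → ℂ) (n : ℕ → ℕ)
          (hB : (Setting.ofAdelic pl hdef hgen R μ hT hT').IsAdaptedONB τ φ n)
          (f₁ f₂ : GA pl → ℂ) (o₀ : (Setting.ofAdelic pl hdef hgen R μ hT hT').Orbit),
          RTF.IsTest f₁ ∧ RTF.IsTest f₂ ∧ RTF.IsTest ((Setting.ofAdelic pl hdef hgen R μ hT hT').conv f₁ f₂) ∧
          (Setting.ofAdelic pl hdef hgen R μ hT hT').geoSupport
            ((Setting.ofAdelic pl hdef hgen R μ hT hT').conv f₁ f₂) = {o₀} ∧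
          (Setting.ofAdelic pl hdef hgen R μ hT hT').orbital R.chi R.chi' o₀
            ((Setting.ofAdelic pl hdef hgen R μ hT hT').conv f₁ f₂) ≠ 0 ∧
          ∃ (N : ℕ) (hN : N ≠ 0)
            (tf : ((d.relevel Γ' hΓ'.1 a' ha').concreteWitness (d.relevel Γ' hΓ'.1 a' ha').isLevel_self
              (isDomain_dom _ (d.relevel Γ' hΓ'.1 a' ha').isLevel_self).subset_ball
              (isDomain_dom _ (d.relevel Γ' hΓ'.1 a' ha').isLevel_self).measurableSet
              ((d.relevel Γ' hΓ'.1 a' ha').residual_of_cocompact (d.relevel Γ' hΓ'.1 a' ha').isLevel_self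
                hcc)).Translates → (GA pl → ℂ) × (GA pl → ℂ))
            (dσ : ℕ) (σ : archImageLevel pl N →* Matrix (Fin dσ) (Fin dσ) ℂ) (hσc : Continuous σ)
            (hσu : ∀ u, (σ u).conjTranspose * σ u = 1)
            (hσirr : ∀ U : Submodule ℂ (Fin dσ → ℂ), (∀ u, ∀ v ∈ U, (σ u).mulVec v ∈ U) → U = ⊥ ∨ U = ⊤),
            (∀ γ, RTF.IsTest (tf γ).1) ∧ (∀ γ, RTF.IsTest (tf γ).2) ∧
            HodgePairingEqJ (Setting.ofAdelic pl hdef hgen R μ hT hT') R.chi R.chi' tf ∧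
            (∀ i j : ↥(instanceSupport pl hdef hgen R μ hT hT' htot hN σ hσc hσu hB), i ≠ j →
              ¬ (Setting.ofAdelic pl hdef hgen R μ hT hT').IsoRep
                (instanceCore pl hdef hgen R μ hT hT' htot hN σ hσc hσu hσirr hB i)
                (instanceCore pl hdef hgen R μ hT hT' htot hN σ hσc hσu hσirr hB j)) ∧
            (∀ m, (Setting.ofAdelic pl hdef hgen R μ hT hT').PeriodNonzeroT R.chi (τ m) →
              ∃ w ∈ RTF.Setting.blockAdmissible τ m
                (RTF.Setting.isotypicFixed (Setting.ofAdelic pl hdef hgen R μ hT hT') (finLevel pl N)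
                  (instanceType pl N σ) (isOpen_finLevel pl hN) (isCompact_finLevel_of_totallyDefinite pl htot hN)
                  (continuous_instanceType pl N σ hσc)),
                (Setting.ofAdelic pl hdef hgen R μ hT hT').periodT R.chi (fun t => w t) ≠ 0) ∧
            (∀ m, (Setting.ofAdelic pl hdef hgen R μ hT hT').PeriodNonzeroT' R.chi' (τ m) →
              ∃ w' ∈ RTF.Setting.blockAdmissible τ m
                (RTF.Setting.isotypicFixed (Setting.ofAdelic pl hdef hgen R μ hT hT') (finLevel pl N)
                  (instanceType pl N σ) (isOpen_finLevel pl hN) (isCompact_finLevel_of_totallyDefinite pl htot hN)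
                  (continuous_instanceType pl N σ hσc)),
                (Setting.ofAdelic pl hdef hgen R μ hT hT').periodT' R.chi' (fun t' => w' t') ≠ 0) ∧
            RealisedHecke (Setting.ofAdelic pl hdef hgen R μ hT hT') R.chi R.chi' φ n tf
              (RTF.Setting.HeckeAlg (Setting.ofAdelic pl hdef hgen R μ hT hT') (finLevel pl N)
                (instanceType pl N σ) (isOpen_finLevel pl hN) (isCompact_finLevel_of_totallyDefinite pl htot hN)
                (continuous_instanceType pl N σ hσc) (isIrreducibleRep_instanceType pl N σ hσirr))
              (fun t => (t : GA pl → ℂ))) :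
    P_T4v3 := by
  refine P_T4v3_of_rtf_isolated fun F E _ _ _ _ _ _ _ _ d => ?_
  obtain ⟨Γ', hΓ', a', ha', hN2, hcc, k, _, _, pl, hdef, hgen, _, _, R, μ, _, _, _, hT, hT', htot, hc, hu, hc', hu',
    τ, φ, n, hB, f₁, f₂, o₀, h₁, h₂, hconv, hiso, hne, N, hN, tf, dσ, σ, hσc, hσu, hσirr, htf₁, htf₂, hJ, hM, hPA,
    hPA', hreal⟩ := h F E d
  have hχ : (Setting.ofAdelic pl hdef hgen R μ hT hT').IsCharacter R.chi :=
    isCharacter_ofAdelic pl hdef hgen R μ hT hT' hc hu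
  have hχ' : (Setting.ofAdelic pl hdef hgen R μ hT hT').IsCharacter' R.chi' :=
    isCharacter'_ofAdelic pl hdef hgen R μ hT hT' hc' hu'
  exact ⟨Γ', hΓ', a', ha', hN2, hcc, GA pl, inferInstance, inferInstance, inferInstance, inferInstance,
    inferInstance, Setting.ofAdelic pl hdef hgen R μ hT hT', R.chi, R.chi', τ, φ, n, f₁, f₂, o₀, fun _ => True, tf,
    hχ, hχ', hB, h₁, h₂, hconv, hiso, hne, fun _ _ _ _ => trivial,
    (spectralIdentificationAt_iff_J (Setting.ofAdelic pl hdef hgen R μ hT hT') R.chi R.chi' τ φ n tf hχ hχ' hB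
      htf₁ htf₂).2 (fun γ _ _ => hJ γ),
    isolationRealised_ofAdelic_instance pl hdef hgen R μ hT hT' htot hN σ hσc hσu hσirr hB (fun _ => True) tf hM hPA
      hPA' hreal⟩

end PackerMin

section Weaker

variable {k : Type} [Field k] [NumberField k] (pl : PlaneData k) (hdef : IsDefinite pl) (hgen : IsGenuineRow pl)
  [MeasurableSpace (GA pl)] [BorelSpace (GA pl)] (R : RTFData pl) (μ : Measure (GA pl)) [μ.IsHaarMeasure]
  [R.μT.IsHaarMeasure] [R.μT'.IsHaarMeasure] (hT : IsCompact (closure R.DT)) (hT' : IsCompact (closure R.DT'))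
  (htot : IsTotallyDefinite pl) (hc : Continuous R.chi) (hu : ∀ a, ‖R.chi a‖ = 1) (hc' : Continuous R.chi')
  (hu' : ∀ a, ‖R.chi' a‖ = 1) {Form : Type} [AddCommGroup Form] [Module ℂ Form] {A : FormAlgebra Form}
  {Wt : Witness A}

include hc hu hc' hu' in
/-- **the minimal display is the WEAKER hypothesis**: on a totally definite plane with continuous unitary characters, p5's
`∀`-block display (the clause of `P_T4v3_of_instance_displayed` at one plane) supplies the minimal one — p4's block
`defined_inputs_realisable_finiteRankType_biInvariant_of_totallyDefinite` by name, its own level `N`, `Lift` and `hlift`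
discarded. -/
theorem instance_displayed_min_of_displayed
    (hdisp : ∀ (τ : ℕ → Set (GA pl → ℂ)) (φ : ℕ → GA pl → ℂ) (n : ℕ → ℕ) (N : ℕ) (f₁ f₂ : GA pl → ℂ)
      (o₀ : (Setting.ofAdelic pl hdef hgen R μ hT hT').Orbit)
      (hB : (Setting.ofAdelic pl hdef hgen R μ hT hT').IsAdaptedONB τ φ n) (hN : N ≠ 0),
      RTF.IsTest f₁ → RTF.IsTest f₂ → RTF.IsTest ((Setting.ofAdelic pl hdef hgen R μ hT hT').conv f₁ f₂) →
      (Setting.ofAdelic pl hdef hgen R μ hT hT').geoSupport ((Setting.ofAdelic pl hdef hgen R μ hT hT').conv f₁ f₂) = {o₀} →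
      (Setting.ofAdelic pl hdef hgen R μ hT hT').orbital R.chi R.chi' o₀
        ((Setting.ofAdelic pl hdef hgen R μ hT hT').conv f₁ f₂) ≠ 0 →
      RTF.HasFiniteRankLeftType (finLevel pl N) f₁ →
      (∀ k ∈ levelK pl N, ∀ x, f₁ (x * k) = f₁ x ∧ f₁ (k * x) = f₁ x) →
      ∃ (Lift : ℕ → Prop) (tf : Wt.Translates → (GA pl → ℂ) × (GA pl → ℂ)) (dσ : ℕ)
        (σ : archImageLevel pl N →* Matrix (Fin dσ) (Fin dσ) ℂ) (hσc : Continuous σ)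
        (hσu : ∀ u, (σ u).conjTranspose * σ u = 1)
        (hσirr : ∀ U : Submodule ℂ (Fin dσ → ℂ), (∀ u, ∀ v ∈ U, (σ u).mulVec v ∈ U) → U = ⊥ ∨ U = ⊤),
        (∀ γ, RTF.IsTest (tf γ).1) ∧ (∀ γ, RTF.IsTest (tf γ).2) ∧
        (∀ m, (Setting.ofAdelic pl hdef hgen R μ hT hT').PeriodNonzeroT R.chi (τ m) →
          (Setting.ofAdelic pl hdef hgen R μ hT hT').PeriodNonzeroT' R.chi' (τ m) →
          (Setting.ofAdelic pl hdef hgen R μ hT hT').Hit (RTF.cj f₁) (τ m) → Lift m) ∧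
        HodgePairingEqJ (Setting.ofAdelic pl hdef hgen R μ hT hT') R.chi R.chi' tf ∧
        (∀ i j : ↥(instanceSupport pl hdef hgen R μ hT hT' htot hN σ hσc hσu hB), i ≠ j →
          ¬ (Setting.ofAdelic pl hdef hgen R μ hT hT').IsoRep
            (instanceCore pl hdef hgen R μ hT hT' htot hN σ hσc hσu hσirr hB i)
            (instanceCore pl hdef hgen R μ hT hT' htot hN σ hσc hσu hσirr hB j)) ∧
        (∀ m, (Setting.ofAdelic pl hdef hgen R μ hT hT').PeriodNonzeroT R.chi (τ m) →
          ∃ w ∈ RTF.Setting.blockAdmissible τ m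
            (RTF.Setting.isotypicFixed (Setting.ofAdelic pl hdef hgen R μ hT hT') (finLevel pl N)
              (instanceType pl N σ) (isOpen_finLevel pl hN) (isCompact_finLevel_of_totallyDefinite pl htot hN)
              (continuous_instanceType pl N σ hσc)),
            (Setting.ofAdelic pl hdef hgen R μ hT hT').periodT R.chi (fun t => w t) ≠ 0) ∧
        (∀ m, (Setting.ofAdelic pl hdef hgen R μ hT hT').PeriodNonzeroT' R.chi' (τ m) →
          ∃ w' ∈ RTF.Setting.blockAdmissible τ m
            (RTF.Setting.isotypicFixed (Setting.ofAdelic pl hdef hgen R μ hT hT') (finLevel pl N)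
              (instanceType pl N σ) (isOpen_finLevel pl hN) (isCompact_finLevel_of_totallyDefinite pl htot hN)
              (continuous_instanceType pl N σ hσc)),
            (Setting.ofAdelic pl hdef hgen R μ hT hT').periodT' R.chi' (fun t' => w' t') ≠ 0) ∧
        RealisedHecke (Setting.ofAdelic pl hdef hgen R μ hT hT') R.chi R.chi' φ n tf
          (RTF.Setting.HeckeAlg (Setting.ofAdelic pl hdef hgen R μ hT hT') (finLevel pl N)
            (instanceType pl N σ) (isOpen_finLevel pl hN) (isCompact_finLevel_of_totallyDefinite pl htot hN)
            (continuous_instanceType pl N σ hσc) (isIrreducibleRep_instanceType pl N σ hσirr))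
          (fun t => (t : GA pl → ℂ))) :
    ∃ (τ : ℕ → Set (GA pl → ℂ)) (φ : ℕ → GA pl → ℂ) (n : ℕ → ℕ)
      (hB : (Setting.ofAdelic pl hdef hgen R μ hT hT').IsAdaptedONB τ φ n)
      (f₁ f₂ : GA pl → ℂ) (o₀ : (Setting.ofAdelic pl hdef hgen R μ hT hT').Orbit),
      RTF.IsTest f₁ ∧ RTF.IsTest f₂ ∧ RTF.IsTest ((Setting.ofAdelic pl hdef hgen R μ hT hT').conv f₁ f₂) ∧
      (Setting.ofAdelic pl hdef hgen R μ hT hT').geoSupport ((Setting.ofAdelic pl hdef hgen R μ hT hT').conv f₁ f₂) = {o₀} ∧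
      (Setting.ofAdelic pl hdef hgen R μ hT hT').orbital R.chi R.chi' o₀
        ((Setting.ofAdelic pl hdef hgen R μ hT hT').conv f₁ f₂) ≠ 0 ∧
      ∃ (N : ℕ) (hN : N ≠ 0) (tf : Wt.Translates → (GA pl → ℂ) × (GA pl → ℂ)) (dσ : ℕ)
        (σ : archImageLevel pl N →* Matrix (Fin dσ) (Fin dσ) ℂ) (hσc : Continuous σ)
        (hσu : ∀ u, (σ u).conjTranspose * σ u = 1)
        (hσirr : ∀ U : Submodule ℂ (Fin dσ → ℂ), (∀ u, ∀ v ∈ U, (σ u).mulVec v ∈ U) → U = ⊥ ∨ U = ⊤),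
        (∀ γ, RTF.IsTest (tf γ).1) ∧ (∀ γ, RTF.IsTest (tf γ).2) ∧
        HodgePairingEqJ (Setting.ofAdelic pl hdef hgen R μ hT hT') R.chi R.chi' tf ∧
        (∀ i j : ↥(instanceSupport pl hdef hgen R μ hT hT' htot hN σ hσc hσu hB), i ≠ j →
          ¬ (Setting.ofAdelic pl hdef hgen R μ hT hT').IsoRep
            (instanceCore pl hdef hgen R μ hT hT' htot hN σ hσc hσu hσirr hB i)
            (instanceCore pl hdef hgen R μ hT hT' htot hN σ hσc hσu hσirr hB j)) ∧
        (∀ m, (Setting.ofAdelic pl hdef hgen R μ hT hT').PeriodNonzeroT R.chi (τ m) →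
          ∃ w ∈ RTF.Setting.blockAdmissible τ m
            (RTF.Setting.isotypicFixed (Setting.ofAdelic pl hdef hgen R μ hT hT') (finLevel pl N)
              (instanceType pl N σ) (isOpen_finLevel pl hN) (isCompact_finLevel_of_totallyDefinite pl htot hN)
              (continuous_instanceType pl N σ hσc)),
            (Setting.ofAdelic pl hdef hgen R μ hT hT').periodT R.chi (fun t => w t) ≠ 0) ∧
        (∀ m, (Setting.ofAdelic pl hdef hgen R μ hT hT').PeriodNonzeroT' R.chi' (τ m) →
          ∃ w' ∈ RTF.Setting.blockAdmissible τ m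
            (RTF.Setting.isotypicFixed (Setting.ofAdelic pl hdef hgen R μ hT hT') (finLevel pl N)
              (instanceType pl N σ) (isOpen_finLevel pl hN) (isCompact_finLevel_of_totallyDefinite pl htot hN)
              (continuous_instanceType pl N σ hσc)),
            (Setting.ofAdelic pl hdef hgen R μ hT hT').periodT' R.chi' (fun t' => w' t') ≠ 0) ∧
        RealisedHecke (Setting.ofAdelic pl hdef hgen R μ hT hT') R.chi R.chi' φ n tf
          (RTF.Setting.HeckeAlg (Setting.ofAdelic pl hdef hgen R μ hT hT') (finLevel pl N)
            (instanceType pl N σ) (isOpen_finLevel pl hN) (isCompact_finLevel_of_totallyDefinite pl htot hN)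
            (continuous_instanceType pl N σ hσc) (isIrreducibleRep_instanceType pl N σ hσirr))
          (fun t => (t : GA pl → ℂ)) := by
  obtain ⟨τ, φ, n, hB, N, f₁, f₂, o₀, hN, h₁, h₂, hconv, hiso, hne, htype, hbi⟩ :=
    defined_inputs_realisable_finiteRankType_biInvariant_of_totallyDefinite pl hdef hgen R μ hT hT' htot hc hu hc' hu'
  obtain ⟨_, tf, dσ, σ, hσc, hσu, hσirr, htf₁, htf₂, _, hJ, hM, hPA, hPA', hreal⟩ :=
    hdisp τ φ n N f₁ f₂ o₀ hB hN h₁ h₂ hconv hiso hne htype hbi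
  exact ⟨τ, φ, n, hB, f₁, f₂, o₀, h₁, h₂, hconv, hiso, hne, N, hN, tf, dσ, σ, hσc, hσu, hσirr, htf₁, htf₂, hJ, hM,
    hPA, hPA', hreal⟩

end Weaker

end Summit.Ventures.HodgeRepro.Tier4.Line1

end
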